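import Summits.HodgeConjecture.HodgeCM.Automorphic.WeilThetaModelLevi_1

/-! PORT of `HodgeCM/Automorphic/WeilThetaModelLevi.lean` (HodgeCMPerL run 82) — part 2: continuation of `Summits.HodgeConjecture.HodgeCM.Automorphic.WeilThetaModelLevi_1` (split at a top-level declaration boundary by port_pkg.py; scope re-opened below; declarations unchanged). -/

-- port_pkg: scope re-opened for this part (file-level context, then the namespace/section stack open at the cut)
set_option autoImplicit false
noncomputable section
open Topology Filter
open scoped RealInnerProductSpace SchwartzMap
namespace HodgeCM
namespace SchwartzWeil
section ExpModel
variable (V : Type) [NormedAddCommGroup V] [InnerProductSpace ℝ V] [FiniteDimensional ℝ V] [MeasurableSpace V]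
  [BorelSpace V] (L : Submodule ℤ V) [DiscreteTopology L] (m : ℤ) (Γz : Subgroup Circle)
  (hΓz : ∀ z ∈ Γz, z ^ m = 1)
/-- At the base point the theta kernel of `ω(inr A)Ψ` is the bare theta series of `L` transported by `A⁻¹`:
`θ_{ω(inr A)Ψ}(1, 1) = Σ_{v ∈ L} Ψ(A⁻¹ v)`. -/
theorem θ_leviModel_of_one (A : V ≃L[ℝ] V) (Ψ : 𝓢(V, ℂ)) :
    (leviModel V L m Γz hΓz).θ
        ((leviModel V L m Γz hΓz).omg (SemidirectProduct.inr (GLd.of A)) ⟨Ψ, Set.mem_univ Ψ⟩)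
        (QuotientGroup.mk 1, QuotientGroup.mk 1) = ∑' v : L, Ψ (A.symm (v : V)) := by
  rw [WeilThetaModel.θ_mk, Prod.mk_one_one, inv_one, map_one, leviModel_omg_inr_of]
  show thetaSD V L m (gl_intertwines V m) (SchwartzMap.compCLMOfContinuousLinearEquiv ℂ A.symm Ψ) 1 = _
  rw [thetaSD_def, repSD_one_apply, thetaH_one]
  rfl

/-- **Differentiation under the theta series along every linear flow, as a COROLLARY of the structural laws**:
for every Schwartz `Φ` on `V`, every `X ∈ End(V)` and every `s₀`,
`d/ds|_{s₀} Σ_{v ∈ L} Φ(exp(sX) v) = Σ_{v ∈ L} (DΦ[X·])(exp(s₀X) v)` (the model with `m = 1`, `Γz = ⊥`, along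
`exp(s(-X))`, at the base point). -/
theorem hasDerivAt_tsum_schwartz_linearFlow (X : V →L[ℝ] V) (Φ : 𝓢(V, ℂ)) (s₀ : ℝ) :
    HasDerivAt (fun s => ∑' v : L, Φ (NormedSpace.exp (s • X) (v : V)))
      (∑' v : L, flowGen X Φ (NormedSpace.exp (s₀ • X) (v : V))) s₀ := by
  have hΓ : ∀ z ∈ (⊥ : Subgroup Circle), z ^ (1 : ℤ) = 1 := fun z hz => by
    rw [Subgroup.mem_bot] at hz
    rw [hz, one_zpow]
  have hsymm : ∀ (s : ℝ) (v : V), (expGL V (-X) s).symm v = NormedSpace.exp (s • X) v := fun s v => by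
    rw [expGL_symm, expGL_apply, neg_smul_neg]
  have h := hasDerivAt_θ_leviModel_exp V L 1 ⊥ hΓ (-X) Φ s₀ (QuotientGroup.mk 1, QuotientGroup.mk 1)
  rw [θ_leviModel_of_one, neg_neg, show (fun s => (leviModel V L 1 ⊥ hΓ).θ ((leviModel V L 1 ⊥ hΓ).omg
      (SemidirectProduct.inr (GLd.of (expGL V (-X) s))) ⟨Φ, Set.mem_univ Φ⟩) (QuotientGroup.mk 1, QuotientGroup.mk 1)) =
      fun s => ∑' v : L, Φ (NormedSpace.exp (s • X) (v : V)) from funext fun s => by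
        rw [θ_leviModel_of_one]; exact tsum_congr fun v => by rw [hsymm]] at h
  simpa only [hsymm] using h

end ExpModel

end SchwartzWeil
end HodgeCM

end
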